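/-
Copyright (c) 2026 the pub-hodgecm-mathlib formalisation cell (harness21).  Prover seat hodgecm-mathlib-F0P2-p09 (g0), re-dealt to L1
`stub_firstTermThetaPairing` (director s1969∕s1970); hLiu418 = `stmt-HodgeConjecture-24832`; I4-conv (F′-fact): the `hΨK` binder (integrality of the local transport).
-/
import Summits.HodgeConjecture.HodgeConjecture.Theorems.K2LiuKlingenInnerSectionLocalDefs    -- ★ B: `psiLoc`, `psiLoc_apply`, `evalPlace_finPart_eq_evalAt`
import Literature.NumberTheory.Automorphic.QuadraticAdeleBaseChange                         -- ★ `eventually_forall_placesOver`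
import HarnessLib

/-!
# Crux `HLiu418`, I4-conv (F′-fact) — `K2LiuKlingenTransportIntegral`: THE LOCAL TRANSPORT `Ψ_v` PRESERVES INTEGRAL POINTS AT ALMOST EVERY PLACE
# (`S_w, S_w⁻¹ ∈ GL_N(𝒪_w)` for all `w ∣ v` ⇒ `Ψ_v(K_v) ≤ K'_v`; and `S_w ∈ GL_N(𝒪_w)` for almost all `v`) — the binder `hΨK` of ★ hK ∕ ★ E-1

Cell `hodgecm-mathlib`, crux item hLiu418 = `stmt-HodgeConjecture-24832`; squad K2 ∕ K2Liu (re-dealt hand F0P2-p09 (g0)); LEAD F0P6-plan (g14); desk K2Liu-p14 (g3) (16:22:12Z,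
(PR5) «OPTIONAL `psiLoc_mapsTo_localInt_of_integral` = the `hΨK` binder of ★ hK `innerSectionLoc_lambdaLoc_mul_localInt` ∕ ★ E-1 `local_factor_eq_one` + the cofinite statement»).
THEOREMS ONLY (no `def`, no instance, no notation, no named-fact hypothesis, no `sorry`); lane `--supports stmt-HodgeConjecture-24832 --as helper`.
Companion of `K2LiuKlingenTransportPlaceReading` ((PR1)–(PR4), 📤 p861929).

* **`evalPlace_psiLoc_eq_conj`** — the GL-level place reading: `(psiLoc Ψ v z)_w = S_w · z_w · S_w⁻¹` in `GL_N(L_w)`, `S_w = GLn.evalAt N L w (GLn.sndHom N L S_𝔸)`, for `Ψ` pinned by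
  `hΨ : (Ψ g) = S_𝔸 · adelicVal g · S_𝔸⁻¹` (★ B `psiLoc_apply`, `evalPlace_finPart_eq_evalAt`, ★ `evalPlace_finPart_inclPlaceAdelic`);
* **`psiLoc_mem_localInt_of_mem`** (= (PR5)) — if `S_w ∈ GL_N(𝒪_w)` for every `w ∣ v` then `psiLoc Ψ v` maps `K_v = localInt N J v` into `K'_v = localInt N J' v`
  (★ `mem_localInt_iff`, `glInt` is a subgroup);
* **`eventually_forall_evalAt_sndHom_mem_glInt`** — `S_w ∈ GL_N(𝒪_w)` for all `w ∣ v`, for almost all places `v` of `L⁺` (★ `GLn.eventually_evalAt_mem_glInt` + ★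
  `eventually_forall_placesOver`), hence **`eventually_psiLoc_mapsTo_localInt`**: `∀ᶠ v, Ψ_v(K_v) ⊆ K'_v`.
[BorelJacquet1979, §4.1], [PlatonovRapinchuk1994, §5.1], [CasselsFrohlichANT1967, Ch. II §14].
HONEST LABEL.  Count-neutral helper: `HC_CM` is proved only modulo the 7 printed citations (2 remaining named inputs: hLiu418 = `stmt-HodgeConjecture-24832`,
h413 = `stmt-HodgeConjecture-24833`) until rung 0 closes; this file closes no socket by itself.

## Mathlib ∕ tree search
Tree ★: B `psiLoc_apply`, `evalPlace_finPart_eq_evalAt`; `UnitaryGroup.{evalPlace_finPart_inclPlaceAdelic, mem_localInt_iff}`; `GLn.eventually_evalAt_mem_glInt`;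
`UnitaryGroup.eventually_forall_placesOver`.  Mathlib: `Subgroup.mul_mem`, `Subgroup.inv_mem`, `Filter.Eventually.mono`.  Dedup: `rg "psiLoc_mem_localInt|eventually_psiLoc" Summits/` — none.
-/

set_option autoImplicit false
set_option linter.dupNamespace false -- the mandated namespace repeats `HodgeConjecture.HodgeConjecture`

noncomputable section

open scoped Matrix
open NumberField IsDedekindDomain Filter

namespace Summit.HodgeConjecture.HodgeConjecture.Cruxes.HLiu418.K2LiuKlingenTransportIntegral

open Literature.NumberTheory.Automorphic Literature.NumberTheory.Automorphic.UnitaryGroup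
open Literature.NumberTheory.GelbartRogawski1991 Literature.NumberTheory.GelbartRogawski1991.GRConstruction
open Summit.HodgeConjecture.HodgeConjecture.Cruxes.HLiu418.K2LiuKlingenInnerSectionLocalDefs

variable (L : Type) [Field L] [NumberField L] [IsCMField L] (v : HeightOneSpectrum (𝓞 (Fp L)))

/-- **`(Ψ_v z)_w = S_w · z_w · S_w⁻¹` in `GL_N(L_w)`** (`S_w = GLn.evalAt N L w (GLn.sndHom N L S_𝔸)`) for `Ψ` pinned by `hΨ`. [cite: BorelJacquet1979, §4.1] [cite: PlatonovRapinchuk1994, §5.1] -/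
theorem evalPlace_psiLoc_eq_conj {N : ℕ} {J J' : Matrix (Fin N) (Fin N) L}
    (Ψ : (adelicGroupData (Fp L) L (IsCMField.complexConj L) N J).Adelic →* (adelicGroupData (Fp L) L (IsCMField.complexConj L) N J').Adelic)
    (SA : GL (Fin N) (AdeleRing (𝓞 L) L))
    (hΨ : ∀ g : (adelicGroupData (Fp L) L (IsCMField.complexConj L) N J).Adelic,
      (((Ψ g).1 : GL (Fin N) (AdeleRing (𝓞 L) L)) : Matrix (Fin N) (Fin N) (AdeleRing (𝓞 L) L)) =
        (SA : Matrix (Fin N) (Fin N) (AdeleRing (𝓞 L) L)) *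
          ((adelicVal (Fp L) L (IsCMField.complexConj L) N J g : GL (Fin N) (AdeleRing (𝓞 L) L)) : Matrix (Fin N) (Fin N) (AdeleRing (𝓞 L) L)) *
          ((SA⁻¹ : GL (Fin N) (AdeleRing (𝓞 L) L)) : Matrix (Fin N) (Fin N) (AdeleRing (𝓞 L) L)))
    (z : UnitaryGroup.localPi L (IsCMField.complexConj L) N J v) (w : UnitaryGroup.PlacesOver L v) :
    ((psiLoc L Ψ v z : UnitaryGroup.localPi L (IsCMField.complexConj L) N J' v) : UnitaryGroup.LocalGLPi L N v) w =
      GLn.evalAt N L w.1 (GLn.sndHom N L SA) * (z : UnitaryGroup.LocalGLPi L N v) w * (GLn.evalAt N L w.1 (GLn.sndHom N L SA))⁻¹ := by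
  have hΨ' : ∀ g : (adelicGroupData (Fp L) L (IsCMField.complexConj L) N J).Adelic, ((Ψ g).1 : GL (Fin N) (AdeleRing (𝓞 L) L)) = SA * g.1 * SA⁻¹ := fun g =>
    Units.ext (by rw [hΨ g, Units.val_mul, Units.val_mul, adelicVal_apply])
  have h1 := evalPlace_finPart_eq_evalAt L v (UnitaryGroup.inclPlaceAdelic (Fp L) L (IsCMField.complexConj L) N J v z) w
  rw [UnitaryGroup.evalPlace_finPart_inclPlaceAdelic] at h1
  rw [psiLoc_apply, evalPlace_finPart_eq_evalAt, hΨ', map_mul, map_mul, map_inv, map_mul, map_mul, map_inv, ← h1]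

/-- **(PR5) `Ψ_v(K_v) ≤ K'_v` when `S_w ∈ GL_N(𝒪_w)` for every `w ∣ v`** — the binder `hΨK` of ★ hK `innerSectionLoc_lambdaLoc_mul_localInt` ∕ ★ E-1 `local_factor_eq_one`
(★ `mem_localInt_iff`: `K_v = {u | ∀ w ∣ v, u_w ∈ GL_N(𝒪_w)}`; `GL_N(𝒪_w)` is a subgroup). [cite: BorelJacquet1979, §4.1] [cite: PlatonovRapinchuk1994, §5.1] -/
theorem psiLoc_mem_localInt_of_mem {N : ℕ} {J J' : Matrix (Fin N) (Fin N) L}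
    (Ψ : (adelicGroupData (Fp L) L (IsCMField.complexConj L) N J).Adelic →* (adelicGroupData (Fp L) L (IsCMField.complexConj L) N J').Adelic)
    (SA : GL (Fin N) (AdeleRing (𝓞 L) L))
    (hΨ : ∀ g : (adelicGroupData (Fp L) L (IsCMField.complexConj L) N J).Adelic,
      (((Ψ g).1 : GL (Fin N) (AdeleRing (𝓞 L) L)) : Matrix (Fin N) (Fin N) (AdeleRing (𝓞 L) L)) =
        (SA : Matrix (Fin N) (Fin N) (AdeleRing (𝓞 L) L)) *
          ((adelicVal (Fp L) L (IsCMField.complexConj L) N J g : GL (Fin N) (AdeleRing (𝓞 L) L)) : Matrix (Fin N) (Fin N) (AdeleRing (𝓞 L) L)) *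
          ((SA⁻¹ : GL (Fin N) (AdeleRing (𝓞 L) L)) : Matrix (Fin N) (Fin N) (AdeleRing (𝓞 L) L)))
    (hS : ∀ w : UnitaryGroup.PlacesOver L v, GLn.evalAt N L w.1 (GLn.sndHom N L SA) ∈ glInt N (w.1.adicCompletion L))
    {k : UnitaryGroup.localPi L (IsCMField.complexConj L) N J v} (hk : k ∈ UnitaryGroup.localInt L (IsCMField.complexConj L) N J v) :
    psiLoc L Ψ v k ∈ UnitaryGroup.localInt L (IsCMField.complexConj L) N J' v := by
  rw [UnitaryGroup.mem_localInt_iff] at hk ⊢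
  intro w
  rw [evalPlace_psiLoc_eq_conj L v Ψ SA hΨ k w]
  exact Subgroup.mul_mem _ (Subgroup.mul_mem _ (hS w) (hk w)) (Subgroup.inv_mem _ (hS w))

omit [IsCMField L] in
/-- **`S_w ∈ GL_N(𝒪_w)` for all `w ∣ v`, for almost all places `v` of `L⁺`** (★ `GLn.eventually_evalAt_mem_glInt` over the places of `L`, regrouped over the places of `L⁺`
by ★ `eventually_forall_placesOver`). [cite: BorelJacquet1979, §4.1] [cite: CasselsFrohlichANT1967, Ch. II §14] -/
theorem eventually_forall_evalAt_sndHom_mem_glInt {N : ℕ} (SA : GL (Fin N) (AdeleRing (𝓞 L) L)) :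
    ∀ᶠ v : HeightOneSpectrum (𝓞 (Fp L)) in cofinite, ∀ w : UnitaryGroup.PlacesOver L v, GLn.evalAt N L w.1 (GLn.sndHom N L SA) ∈ glInt N (w.1.adicCompletion L) :=
  eventually_forall_placesOver L (GLn.eventually_evalAt_mem_glInt (GLn.sndHom N L SA))

/-- **`∀ᶠ v, Ψ_v(K_v) ≤ K'_v`**: at almost every place of `L⁺` the local transport maps integral points to integral points — the cofinite form of `hΨK`
(so the finite exceptional set goes into `T′`). [cite: BorelJacquet1979, §4.1] -/
theorem eventually_psiLoc_mapsTo_localInt {N : ℕ} {J J' : Matrix (Fin N) (Fin N) L}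
    (Ψ : (adelicGroupData (Fp L) L (IsCMField.complexConj L) N J).Adelic →* (adelicGroupData (Fp L) L (IsCMField.complexConj L) N J').Adelic)
    (SA : GL (Fin N) (AdeleRing (𝓞 L) L))
    (hΨ : ∀ g : (adelicGroupData (Fp L) L (IsCMField.complexConj L) N J).Adelic,
      (((Ψ g).1 : GL (Fin N) (AdeleRing (𝓞 L) L)) : Matrix (Fin N) (Fin N) (AdeleRing (𝓞 L) L)) =
        (SA : Matrix (Fin N) (Fin N) (AdeleRing (𝓞 L) L)) *
          ((adelicVal (Fp L) L (IsCMField.complexConj L) N J g : GL (Fin N) (AdeleRing (𝓞 L) L)) : Matrix (Fin N) (Fin N) (AdeleRing (𝓞 L) L)) *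
          ((SA⁻¹ : GL (Fin N) (AdeleRing (𝓞 L) L)) : Matrix (Fin N) (Fin N) (AdeleRing (𝓞 L) L))) :
    ∀ᶠ v : HeightOneSpectrum (𝓞 (Fp L)) in cofinite, ∀ k ∈ UnitaryGroup.localInt L (IsCMField.complexConj L) N J v,
      psiLoc L Ψ v k ∈ UnitaryGroup.localInt L (IsCMField.complexConj L) N J' v :=
  (eventually_forall_evalAt_sndHom_mem_glInt L SA).mono fun v hv _ hk => psiLoc_mem_localInt_of_mem L v Ψ SA hΨ hv hk

end Summit.HodgeConjecture.HodgeConjecture.Cruxes.HLiu418.K2LiuKlingenTransportIntegral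

end
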